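import Literature.IUT.HodgeTheaters.CoveringsErrataNecessitySchema
import HarnessLib

/-!
# [IUTchI] Remark 1.2.3 (vii), necessity (`Rmk123.UnrVerticialNecessityReduction`, FACT-LIST row F-1980):
# BINDER-FREE instance form at the smooth-curve origin, and its genuine inhabitants (proof-only)

S. Mochizuki, *Inter-universal Teichmüller theory I*, kurims manuscript (May 2020), §1, Remark 1.2.3 (vii) p. 43 —
the replacement text of the final paragraph of the proof of [CombGC] Theorem 1.6 (iii): "necessity follows formally
from the characterization of unramified verticial subgroups given in Remark 1.4.3 and the characterization of
verticially purely totally ramified finite étale coverings given in Remark 1.4.2"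
[cite: Mochizuki2012, IUTchI Rmk 1.2.3 (vii) p.43] (D-0012 claim key; series status DISPUTED; the content used here is
combinatorial anabelian group theory over abc-iut-L3-t4's interface `PSCDatum`; no side taken).  abc-iut cell, block
F, KEY INST59L1 (seat abc-iut-f-186 gen 3), FACT-LIST row **F-1980**.

The row is typed (`CoveringsErrata.lean`, abc-iut-L5-t6) as the SCHEMA `Rmk123.UnrVerticialNecessityReduction Ω` over
the BLACKBOX origin parameter `Ω : PSCOrigin`.  Kernel status before this file (plan/LF-KERNEL-STATUS.tsv
2026-08-27T12:11Z): universal closure REFUTED (`not_forall_unrVerticialNecessityReduction`, abc-iut-f-187) ·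
conditional closers (`unrVerticialNecessityReduction_of_vertGp_eq_top`, `…_of_unrVerticialIffHolds`, …) · an
`∃ Ω, …`-packaged witness (`exists_smoothProperOrigin_unrVerticialNecessityReduction`) · NO theorem whose HEAD is the
row at a closed origin.  PROOF-ONLY companion (no `def`, no `instance`, nothing re-typed); this file records:

* `unrVerticialNecessityReduction_smoothCurveOrigin` — **INSTANCE FORM, 0 binders, 0 hypotheses**: the row HOLDS at
  the SMOOTH-CURVE ORIGIN `Ω_sm` := "the data with a vertex and `Π_v = Π` for every vertex" (any edges; the shape
  [CombGC] Def. 1.1 (i) extracts from a SMOOTH pointed stable curve — one irreducible component), written inline as an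
  anonymous `PSCOrigin`; by abc-iut-f-187's `unrVerticialNecessityReduction_of_vertGp_eq_top` (from abc-iut-f-009's
  `unrVerticiallyFiltrationPreservingIffVerticial_of_smoothProper`).  GENUINE shape, not a toy;
* `exists_genuine_mem_smoothCurveOrigin` — NON-VACUITY, in the STURDINESS hypotheses too: `Ω_sm` declares of
  PSC-type the genuine sturdy data of (a) a smooth proper genus-2 curve (`Π = Ŝ₂`, `Σ` = all primes, no edge) and
  (b) a smooth genus-2 curve with one marked point (`Π = Γ̂_{2,1}`, one cusp), characteristic 0 — abc-iut-L3-t4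
  lineage's `exists_smoothProperOrigin_holds` / `not_unrVerticialCharacterizationHolds_of_genus2OnePoint`, BY NAME;
* `unrVerticialNecessityReduction_smoothCurveOrigin_decided` — the schema decided both ways in universe 0 with the
  positive side at a CLOSED origin.

HONEST FRAMING: instance-form theorems about OUR typed statement over OUR interface; at `Ω_sm` the row's displayed
[IUTchI] Rmk. 1.2.3 (iv) hypothesis `UnrVerticialSplitInjection` is unsatisfiable for sturdy nonabelian data (finding
F-L3t4g5-1) — the instance says the IMPLICATION typed as F-1980 holds there, nothing about print; typed ≠ proved;
refuted-as-typed (closure) ≠ refuted-in-print; nothing here bears on [IUTchIII] Cor. 3.12 or asserts anything about abc.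
-/

namespace Literature.IUT.HodgeTheaters.Rmk123

open Literature.AnabelianGeometry.SemiGraphs
open Literature.GroupTheory.CombinatorialGroupTheory (PuncturedSurfaceGroup)

/-- **[IUTchI] Rmk. 1.2.3 (vii), necessity, HOLDS at the smooth-curve origin — instance form of F-1980, no binders,
no hypotheses.**  At the origin declaring "of PSC-type" exactly the data with a vertex and `Π_v = Π` for every vertex
(the datum of a smooth curve: one irreducible component), verticially filtration-preserving ⟹ group-theoretically
verticial for every `β : Π^unr_G ≅ Π^unr_H`, granted the row's displayed hypotheses (which are idle here) — by
`unrVerticialNecessityReduction_of_vertGp_eq_top`. [cite: Mochizuki2012, IUTchI Rmk 1.2.3 (vii) p.43] -/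
theorem unrVerticialNecessityReduction_smoothCurveOrigin :
    Literature.IUT.HodgeTheaters.Rmk123.UnrVerticialNecessityReduction
      (⟨fun G => (∀ v, G.vertGp v = ⊤) ∧ Nonempty G.graph.V⟩ : PSCOrigin.{0}) :=
  unrVerticialNecessityReduction_of_vertGp_eq_top _ fun _ _ _ _ h => h

/-- **The smooth-curve origin is inhabited by GENUINE sturdy data, without and with a cusp**: (a) the datum of a
smooth proper genus-2 curve (`Π = Ŝ₂` = profinite completion of `Γ_{2,0}`, `Σ` = all primes, one vertex of genus 2
with `Π_v = Π`, no edge) and (b) the datum of a smooth genus-2 curve with one marked point (`Π = Γ̂_{2,1}`, one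
cusp), both in characteristic 0, are declared of PSC-type by `Ω_sm`.  So
`unrVerticialNecessityReduction_smoothCurveOrigin` is not an instance at an empty origin, and the row's sturdiness
hypotheses are satisfiable there. [cite: Mochizuki2012, IUTchI Rmk 1.2.3 (vii) p.43] -/
theorem exists_genuine_mem_smoothCurveOrigin :
    (∃ G : PSCDatum (profiniteCompletion (PuncturedSurfaceGroup 2 0)),
      (⟨fun G => (∀ v, G.vertGp v = ⊤) ∧ Nonempty G.graph.V⟩ : PSCOrigin.{0}).IsOfPSCType G ∧
        G.IsSturdy ∧ G.Sigma = {p | p.Prime} ∧ G.graph.i = 1 ∧ G.graph.n = 0 ∧ G.graph.r = 0 ∧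
        ∀ v, G.genus v = 2) ∧
    ∃ G : PSCDatum (profiniteCompletion (PuncturedSurfaceGroup 2 1)),
      (⟨fun G => (∀ v, G.vertGp v = ⊤) ∧ Nonempty G.graph.V⟩ : PSCOrigin.{0}).IsOfPSCType G ∧
        G.IsSturdy ∧ G.Sigma = {p | p.Prime} ∧ G.graph.i = 1 ∧ G.graph.n = 0 ∧ G.graph.r = 1 ∧
        ∀ v, G.genus v = 2 := by
  constructor
  · obtain ⟨Ω, ⟨G, -, hst, hS, hi, hn, hr, hv⟩, -⟩ := PSCDatum.exists_smoothProperOrigin_holds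
    have hV : Nonempty G.graph.V :=
      Fintype.card_pos_iff.mp (by rw [show Fintype.card G.graph.V = 1 from hi]; exact Nat.one_pos)
    exact ⟨G, ⟨fun v => (hv v).1, hV⟩, hst, hS, hi, hn, hr, fun v => (hv v).2⟩
  · obtain ⟨G, hS, hi, hn, hr, hst, hv, -, -, -⟩ :=
      PSCDatum.not_unrVerticialCharacterizationHolds_of_genus2OnePoint
    have hV : Nonempty G.graph.V :=
      Fintype.card_pos_iff.mp (by rw [show Fintype.card G.graph.V = 1 from hi]; exact Nat.one_pos)
    exact ⟨G, ⟨fun v => (hv v).1, hV⟩, hst, hS, hi, hn, hr, fun v => (hv v).2⟩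

/-- **F-1980 decided both ways in universe 0, positive side at a closed inhabited origin**: the schema HOLDS at the
smooth-curve origin (inhabited by genuine sturdy data) and FAILS at the all-inclusive origin
(`not_unrVerticialNecessityReduction_all`, abc-iut-f-187). [cite: Mochizuki2012, IUTchI Rmk 1.2.3 (vii) p.43] -/
theorem unrVerticialNecessityReduction_smoothCurveOrigin_decided :
    (∃ Ω : PSCOrigin.{0},
        (∃ G : PSCDatum (profiniteCompletion (PuncturedSurfaceGroup 2 1)), Ω.IsOfPSCType G ∧ G.IsSturdy) ∧
          UnrVerticialNecessityReduction Ω) ∧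
      ¬ ∀ Ω : PSCOrigin.{0}, UnrVerticialNecessityReduction Ω := by
  refine ⟨⟨_, ?_, unrVerticialNecessityReduction_smoothCurveOrigin⟩, not_forall_unrVerticialNecessityReduction⟩
  obtain ⟨G, hG, hst, -⟩ := exists_genuine_mem_smoothCurveOrigin.2
  exact ⟨G, hG, hst⟩

end Literature.IUT.HodgeTheaters.Rmk123
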